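import Mathlib
import Literature.Barriers.ValiantsHypothesis.AlgebraicNaturalProofs
import Literature.Computability.AlgebraicComplexity.ArithCircuitProofs
import Summits.ValiantsHypothesis.ValiantsHypothesis.Theorems.BarrierLeverSuccinctHittingSetsForVPStubRestrict
import Summits.ValiantsHypothesis.ValiantsHypothesis.Theorems.BarrierLeverSuccinctHittingSetsForVPLowDegree
import HarnessLib

/-!
# Crux `BarrierLever.SuccinctHittingSetsForVP` (stmt-ValiantsHypothesis-14610), line `registered` —
stub `stub_separableCoeff`: SEPARABLE (RANK-ONE) COEFFICIENT TENSORS ARE SUCCINCT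

**What is proved (unconditional; a worker-sized stub of the generator form of the sparse half, it
does NOT close the item).** In FSV's framework over `ℂ` (tree regime `d = n`, coefficient variables
indexed by `degLEMonomials n`, simple class `SmallCircuits ℂ n b = {f : deg f ≤ n, L(f) ≤ n^b}`):

* `stub_separableCoeff` : for every `n ≥ 8` and every table of univariate coefficient sequences
  `c_i : ℕ → ℂ` (`i < n`) there is `Λ ∈ SmallCircuits ℂ n 8` whose coefficient at every monomial
  `x^μ` of degree `≤ n` is the rank-one tensor `∏_i c_i(μ_i)`.

This is the succinctness of Forbes–Shpilka–Volk's Construction 25 (the succinct Shpilka–Volkovich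
generator is built from products of univariates) transported to the regime `d = n`.

**Proof.** Let `g := ∏_i Σ_{k ≤ n} c_i(k) x_i^k` (a product of univariates in distinct variables).
Expanding (`Finset.prod_univ_sum`) gives `g = Σ_κ (∏_i c_i(κ_i)) x^κ` over `κ : Fin n → {0..n}`,
so `coeff_μ g = ∏_i c_i(μ_i)` whenever every `μ_i ≤ n` — in particular for `|μ| ≤ n`;
`deg g ≤ n · n`; and `L(g) ≤ n (n+1)(n+2) + n` (`L(c x_i^k) ≤ k + 1`, summed and multiplied without
sharing). The witness `Λ` is the degree-`≤ n` truncation of `g` (`StubRestrict.exists_truncate`: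
homogeneous components by interpolation), of size
`≤ (n+1)((n²+1)(L(g) + n + 2)) + (n+1) ≤ 16 n⁶ + 2 n ≤ n⁸` for `n ≥ 8`. Axioms: `propext`,
`Classical.choice`, `Quot.sound`.

References: [ForbesShpilkaVolk2018] Construction 25 and Fact 26 (succinctness of the SV
generator); [Burgisser2000] Def. 2.1, §2.1 (the complexity measure).
-/

-- layout Summits/ValiantsHypothesis/ValiantsHypothesis forces the duplicated namespace component
set_option linter.dupNamespace false

namespace Summit.ValiantsHypothesis.ValiantsHypothesis.Theorems.BarrierLever.SuccinctHittingSetsForVP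

open Literature.Barriers.ValiantsHypothesis Literature.Computability.AlgebraicComplexity MvPolynomial

namespace SeparableCoeff

variable {n : ℕ}

section Expansion

/-- `∏_i x_i^{κ_i}` is the monomial `x^κ`. [folklore] -/
theorem prod_X_pow_eq_monomial_fun (κ : Fin n → ℕ) :
    ∏ i, (X i : MvPolynomial (Fin n) ℂ) ^ κ i = monomial (Finsupp.equivFunOnFinite.symm κ) 1 := by
  -- adapted from Literature/RingTheory/MvPolynomial/StandardMonomialCount.lean
  rw [monomial_eq, C_1, one_mul, Finsupp.prod_fintype _ _ (fun i => pow_zero _)]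
  simp only [Finsupp.coe_equivFunOnFinite_symm]

/-- `∏_i a_i x_i^{κ_i} = (∏_i a_i) x^κ`. [folklore] -/
theorem prod_C_mul_X_pow (a : Fin n → ℂ) (κ : Fin n → ℕ) :
    ∏ i, (C (a i) * (X i : MvPolynomial (Fin n) ℂ) ^ κ i) =
      monomial (Finsupp.equivFunOnFinite.symm κ) (∏ i, a i) := by
  rw [Finset.prod_mul_distrib, ← map_prod, prod_X_pow_eq_monomial_fun, C_mul_monomial, mul_one]

/-- **Expansion of a product of univariates in distinct variables**:
`∏_i Σ_{k < N} c_i(k) x_i^k = Σ_{κ : i ↦ κ_i < N} (∏_i c_i(κ_i)) x^κ`. [folklore] -/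
theorem prod_univariate_eq_sum (N : ℕ) (c : Fin n → ℕ → ℂ) :
    (∏ i : Fin n, ∑ k ∈ Finset.range N, C (c i k) * (X i : MvPolynomial (Fin n) ℂ) ^ k) =
      ∑ κ ∈ Fintype.piFinset (fun _ : Fin n => Finset.range N),
        monomial (Finsupp.equivFunOnFinite.symm κ) (∏ i, c i (κ i)) := by
  rw [Finset.prod_univ_sum]
  exact Finset.sum_congr rfl fun κ _ => prod_C_mul_X_pow _ _

/-- **Coefficients of a product of univariates in distinct variables** (FSV Fact 26 in coefficient
form): `coeff_μ ∏_i Σ_{k < N} c_i(k) x_i^k = ∏_i c_i(μ_i)` when every `μ_i < N`.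
[cite: ForbesShpilkaVolk2018, Construction 25 and Fact 26] -/
theorem coeff_prod_univariate (N : ℕ) (c : Fin n → ℕ → ℂ) (μ : Fin n →₀ ℕ) (hμ : ∀ i, μ i < N) :
    coeff μ (∏ i : Fin n, ∑ k ∈ Finset.range N, C (c i k) * (X i : MvPolynomial (Fin n) ℂ) ^ k) =
      ∏ i, c i (μ i) := by
  -- adapted from Literature/RingTheory/MvPolynomial/StandardMonomialCount.lean (coeff_prod_aeval_X)
  rw [prod_univariate_eq_sum, coeff_sum]
  simp only [coeff_monomial]
  rw [Finset.sum_eq_single (⇑μ : Fin n → ℕ)]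
  · rw [if_pos (Finsupp.equivFunOnFinite_symm_coe μ)]
  · intro κ _ hκ
    rw [if_neg]
    intro h
    apply hκ
    rw [← h]
    rfl
  · intro h
    exfalso
    exact h (Fintype.mem_piFinset.mpr fun i => Finset.mem_range.mpr (hμ i))

/-- `deg ∏_i Σ_{k ≤ N} c_i(k) x_i^k ≤ n N`. [folklore] -/
theorem totalDegree_prod_univariate_le (N : ℕ) (c : Fin n → ℕ → ℂ) :
    (∏ i : Fin n, ∑ k ∈ Finset.range (N + 1),
        C (c i k) * (X i : MvPolynomial (Fin n) ℂ) ^ k).totalDegree ≤ n * N := by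
  have hfac : ∀ i : Fin n, (∑ k ∈ Finset.range (N + 1),
      C (c i k) * (X i : MvPolynomial (Fin n) ℂ) ^ k).totalDegree ≤ N := by
    intro i
    refine totalDegree_finsetSum_le fun k hk => ?_
    have hk' : k ≤ N := Nat.lt_succ_iff.mp (Finset.mem_range.mp hk)
    calc (C (c i k) * (X i : MvPolynomial (Fin n) ℂ) ^ k).totalDegree
        ≤ (C (c i k) : MvPolynomial (Fin n) ℂ).totalDegree +
            ((X i : MvPolynomial (Fin n) ℂ) ^ k).totalDegree := totalDegree_mul _ _
      _ = k := by rw [totalDegree_C, totalDegree_X_pow, zero_add]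
      _ ≤ N := hk'
  calc (∏ i : Fin n, ∑ k ∈ Finset.range (N + 1),
          C (c i k) * (X i : MvPolynomial (Fin n) ℂ) ^ k).totalDegree
      ≤ ∑ i : Fin n, (∑ k ∈ Finset.range (N + 1),
          C (c i k) * (X i : MvPolynomial (Fin n) ℂ) ^ k).totalDegree := totalDegree_finsetProd _ _
    _ ≤ ∑ _i : Fin n, N := by
        gcongr with i _
        exact hfac i
    _ = n * N := by rw [Finset.sum_const, Finset.card_univ, Fintype.card_fin, smul_eq_mul]

end Expansion

section Complexity

/-- `L(Σ_{k ≤ N} c(k) x_i^k) ≤ (N + 1)(N + 2)`: `L(c x_i^k) ≤ k + 1 ≤ N + 1` (free constant, `k`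
multiplications), `N + 1` summands and `N + 1` addition gates. [cite: Burgisser2000, §2.1] -/
theorem complexity_univariate_le (N : ℕ) (c : ℕ → ℂ) (i : Fin n) :
    complexity (∑ k ∈ Finset.range (N + 1), C (c k) * (X i : MvPolynomial (Fin n) ℂ) ^ k) ≤
      (N + 1) * (N + 2) := by
  calc complexity (∑ k ∈ Finset.range (N + 1), C (c k) * (X i : MvPolynomial (Fin n) ℂ) ^ k)
      ≤ ∑ k ∈ Finset.range (N + 1), complexity (C (c k) * (X i : MvPolynomial (Fin n) ℂ) ^ k) +
          (Finset.range (N + 1)).card := complexity_finset_sum_le _ _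
    _ ≤ ∑ _k ∈ Finset.range (N + 1), (N + 1) + (Finset.range (N + 1)).card := by
        gcongr with k hk
        have hk' : k ≤ N := Nat.lt_succ_iff.mp (Finset.mem_range.mp hk)
        have hpow := LowDegree.complexity_X_pow_le (n := n) i k
        calc complexity (C (c k) * (X i : MvPolynomial (Fin n) ℂ) ^ k)
            ≤ complexity (C (c k) : MvPolynomial (Fin n) ℂ) +
                complexity ((X i : MvPolynomial (Fin n) ℂ) ^ k) + 1 := complexity_mul_le_holds _ _
          _ ≤ 0 + k + 1 := by rw [complexity_C_holds]; omega
          _ ≤ N + 1 := by omega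
    _ = (N + 1) * (N + 2) := by rw [Finset.sum_const, Finset.card_range, smul_eq_mul]; ring

/-- `L(∏_i Σ_{k ≤ N} c_i(k) x_i^k) ≤ n (N + 1)(N + 2) + n` (one product gate per factor).
[cite: Burgisser2000, §2.1] -/
theorem complexity_prod_univariate_le (N : ℕ) (c : Fin n → ℕ → ℂ) :
    complexity (∏ i : Fin n, ∑ k ∈ Finset.range (N + 1),
        C (c i k) * (X i : MvPolynomial (Fin n) ℂ) ^ k) ≤ n * ((N + 1) * (N + 2)) + n := by
  calc complexity (∏ i : Fin n, ∑ k ∈ Finset.range (N + 1),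
          C (c i k) * (X i : MvPolynomial (Fin n) ℂ) ^ k)
      ≤ ∑ i : Fin n, complexity (∑ k ∈ Finset.range (N + 1),
          C (c i k) * (X i : MvPolynomial (Fin n) ℂ) ^ k) + (Finset.univ : Finset (Fin n)).card :=
        complexity_finset_prod_le _ _
    _ ≤ ∑ _i : Fin n, (N + 1) * (N + 2) + (Finset.univ : Finset (Fin n)).card := by
        gcongr with i hi
        exact complexity_univariate_le N (c i) i
    _ = n * ((N + 1) * (N + 2)) + n := by
        rw [Finset.sum_const, Finset.card_univ, Fintype.card_fin, smul_eq_mul]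

/-- The final arithmetic: for `n ≥ 8` and `L ≤ n (n+1)(n+2) + n` (so `L + n + 2 ≤ 2 n³`),
`(n+1)((n²+1)(L + n + 2)) + (n+1) ≤ 2n · 2n² · 2n³ + 2n = 8 n⁶ + 2 n ≤ n⁸`. [folklore] -/
theorem final_arith {n L : ℕ} (hn : 8 ≤ n) (hL : L ≤ n * ((n + 1) * (n + 2)) + n) :
    (n + 1) * ((n * n + 1) * (L + n + 2)) + (n + 1) ≤ n ^ 8 := by
  have h1 : n + 1 ≤ 2 * n := by omega
  have h2 : n * n + 1 ≤ 2 * n ^ 2 := by nlinarith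
  have h3 : L + n + 2 ≤ 2 * n ^ 3 := by
    have e1 : n * ((n + 1) * (n + 2)) + n = n ^ 3 + 3 * n ^ 2 + 3 * n := by ring
    have e2 : 8 * n ^ 2 ≤ n ^ 3 := by
      calc 8 * n ^ 2 ≤ n * n ^ 2 := Nat.mul_le_mul_right _ hn
        _ = n ^ 3 := by ring
    have e3 : 8 * n ≤ n ^ 2 := by
      calc 8 * n ≤ n * n := Nat.mul_le_mul_right _ hn
        _ = n ^ 2 := by ring
    rw [e1] at hL
    nlinarith
  have h4 : n ≤ n ^ 6 := Nat.le_self_pow (by norm_num) n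
  have h5 : 64 ≤ n ^ 2 := by
    calc 64 = 8 * 8 := by norm_num
      _ ≤ n * n := Nat.mul_le_mul hn hn
      _ = n ^ 2 := by ring
  calc (n + 1) * ((n * n + 1) * (L + n + 2)) + (n + 1)
      ≤ 2 * n * (2 * n ^ 2 * (2 * n ^ 3)) + 2 * n :=
        add_le_add (Nat.mul_le_mul h1 (Nat.mul_le_mul h2 h3)) h1
    _ = 8 * n ^ 6 + 2 * n := by ring
    _ ≤ 8 * n ^ 6 + 56 * n ^ 6 := by omega
    _ = 64 * n ^ 6 := by ring
    _ ≤ n ^ 2 * n ^ 6 := Nat.mul_le_mul_right _ h5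
    _ = n ^ 8 := by ring

end Complexity

end SeparableCoeff

/-- **Registered stub `stub_separableCoeff`** (crux stmt-ValiantsHypothesis-14610, line `registered`;
separable coefficient tensors are succinct — the succinctness of FSV's Construction 25 in regime
`d = n`): for every `n ≥ 8` and every table of univariate coefficient sequences `c_i : ℕ → ℂ` there
is a small circuit `Λ` (degree `≤ n`, size `≤ n⁸`) whose coefficient at every `x^μ`, `|μ| ≤ n`, is
`∏_i c_i(μ_i)`: the degree-`≤ n` truncation (`StubRestrict.exists_truncate`) of the product of
univariates `∏_i Σ_{k ≤ n} c_i(k) x_i^k` (degree `≤ n²`, size `≤ n (n+1)(n+2) + n`).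
[cite: ForbesShpilkaVolk2018, Construction 25 and Fact 26] -/
theorem stub_separableCoeff :
    ∀ n : ℕ, 8 ≤ n → ∀ c : Fin n → ℕ → ℂ,
      ∃ Λ ∈ SmallCircuits ℂ n 8, ∀ μ : degLEMonomials n,
        MvPolynomial.coeff (μ : Fin n →₀ ℕ) Λ = ∏ i : Fin n, c i ((μ : Fin n →₀ ℕ) i) := by
  intro n hn c
  obtain ⟨Λ, hdeg, hL, hcoeff⟩ := StubRestrict.exists_truncate
    (∏ i : Fin n, ∑ k ∈ Finset.range (n + 1), C (c i k) * (X i : MvPolynomial (Fin n) ℂ) ^ k)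
    (SeparableCoeff.totalDegree_prod_univariate_le n c) n
  refine ⟨Λ, ⟨hdeg, hL.trans
    (SeparableCoeff.final_arith hn (SeparableCoeff.complexity_prod_univariate_le n c))⟩, fun μ => ?_⟩
  have hμ : (μ : Fin n →₀ ℕ).degree ≤ n := μ.2
  rw [hcoeff _ hμ]
  exact SeparableCoeff.coeff_prod_univariate (n + 1) c _ fun i =>
    Nat.lt_succ_of_le ((Finsupp.le_degree i _).trans hμ)

end Summit.ValiantsHypothesis.ValiantsHypothesis.Theorems.BarrierLever.SuccinctHittingSetsForVP
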